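import Literature.NumberTheory.EllipticCurves.LocalEulerCharacteristicTorsion
import Literature.NumberTheory.EllipticCurves.CongruenceVisibilityLocalFactors
import Literature.NumberTheory.EllipticCurves.KummerSelmerStructure
import HarnessLib

/-!
# Route (3e) SELMER COMPANION, VI: the cohomology of a twisted line of `E(K̄_v)` at `v ∣ p`
# (class X11a = N7; cell `b2b-bsdres`, unit `b2b-bsdres-x11a`, gen 27)

HONEST FRAMING (run/shared/lean/b2b/bsd-rank1-residual/, verbatim in every file): the goal of the
cell is to DELETE the COMBINATION-SHAPED residual classes of the Birch–Swinnerton-Dyer formula for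
ALL analytic-rank `≤ 1` elliptic curves over `ℚ` — "full BSD formula for every rank `≤ 1` curve in
class `C`" assembled STRICTLY from published theorems — so that the rank-`≤ 1` remainder becomes
exactly the CONSTRUCTION-SHAPED classes, which are TYPED (missing-input `Prop`s), NOT attempted.
This is not "finishing BSD". CLASS-OWNERS.md: research routes; NO CLAIM BEYOND STATED CLASSES.
THEOREMS ONLY; nothing booked; no label moves. CONDITIONAL on the PUBLISHED named fact
`localEulerPoincareCharacteristic ℚ_v` (Tate's local Euler–Poincaré characteristic formula,
Milne *ADT* I Thm. 2.8 — the tree's named fact, already the `hEuler` input of the cell's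
Cassels–Tate binder) where it is a hypothesis.

## What (lemma L-p-ns of the gen-26 census, step 1 of 3)

Let `v` be the place of `ℚ` above the odd prime `p`, `F = ℚ_v`, `Γ = Γ_F`, and `C ≤ E(F̄)` (the
`F̄`-points of any Weierstrass curve `E = W/ℚ`, the tree's `localPoints`) a `Γ`-STABLE subgroup of
order `p` such that

* (α) some `ι ∈ Γ` acts on a non-zero `T₁ ∈ C` by `2` (`ι T₁ = 2 T₁`), and
* (β) some `σ₀ ∈ Γ` acts on the `p`-th roots of unity of `F̄` by `ζ ↦ ζ^a` and on a non-zero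
  `T₁ ∈ C` by `-a`.

(Both hold for the distinguished line `C ≅ μ_p ⊗ ε` of a NON-SPLIT multiplicative curve at `p` —
`ε` the unramified quadratic character: `ι` an inertia element with `ι ζ = ζ²`, `σ₀` any element
moving `√γ` — and are transported to the kernel-of-reduction line of a good ordinary congruent
partner; file VIII.) THEN `#H¹(Γ_F, C) = p` (`natCard_H1_eq_of_line`): by (α) `C^Γ = 0`; by (β)
`Hom_Γ(C, μ_p) = 0` (an equivariant `f` has `f(T)^{a} = σ₀ f(T) = f(σ₀ T) = f(T)^{-a}`, and
`p ∤ 2a`), which is `#H²(Γ_F, C) = 1` by the tree's PROVED local duality in bidegree `(2,0)`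
(`natCard_two_eq_natCard_invariants_homRep`, Milne I Cor. 2.3); and Tate's Euler characteristic
(the named fact) gives `#H¹ = #C^Γ · #H² · #(ℤ_v / p) = p`.

This is the count behind "at a non-anomalous ordinary prime the local Kummer condition is the image
of `H¹` of the canonical line" (R. Greenberg, LNM 1716, §2 Props. 2.2, 2.4 in the divisible
setting; J. Coates, R. Greenberg, *Kummer theory for abelian varieties over local fields*, Invent.
124 (1996) §4) in the mod-`p` comparison form the Selmer companion route needs; no numbered printed
statement compares a multiplicative curve with a good congruent partner at `p`, so it is PROVED
here (files VI–VIII) from the tree's Galois cohomology.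

References: [MilneADT2006] I Thm. 2.8, Cor. 2.3; [GreenbergLNM1716] §2 Props. 2.2, 2.4;
[SerreGaloisCohomology1997] II §5; HOME/b2b-bsdres-x11a/REPORT-g27.md.
-/

set_option autoImplicit false

noncomputable section

open scoped Classical

open WeierstrassCurve Literature.NumberTheory.EllipticCurves
  Literature.NumberTheory.GaloisRepresentations Field NumberField IsDedekindDomain

namespace Summit.BirchSwinnertonDyer.Rank1Residual.X11a.OrdinaryLine

variable {v : HeightOneSpectrum (𝓞 ℚ)} {p : ℕ} [hp : Fact p.Prime]

/-- `#(ℤ_v / p ℤ_v) = p` at the place `v ∋ p` of `ℚ` (the only place above `p`;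
`∏_{v ∣ p} #(𝓞_v/p) = p^{[ℚ:ℚ]}`). [folklore] -/
theorem natCard_quot_adicCompletionIntegers_rat (hpv : (p : 𝓞 ℚ) ∈ v.asIdeal) :
    Nat.card (v.adicCompletionIntegers ℚ ⧸ Ideal.span {(p : v.adicCompletionIntegers ℚ)}) = p := by
  classical
  have h := prod_natCard_quot_adicCompletionIntegers (K := ℚ) (p := p) {v} (fun v' hv' hpv' ↦ ?_)
  · rw [Finset.prod_singleton, Module.finrank_self, pow_one] at h
    exact h
  · apply hv'
    rw [Finset.mem_singleton]
    apply Rat.HeightOneSpectrum.primesEquiv.injective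
    apply Subtype.ext
    rw [Rat.HeightOneSpectrum.primesEquiv_eq_of_natCast_mem v' hp.out hpv',
      Rat.HeightOneSpectrum.primesEquiv_eq_of_natCast_mem v hp.out hpv]

/-- In a group of prime order `p`, every element is an integer multiple of any non-zero element.
[folklore] -/
theorem exists_zsmul_eq_of_card_prime {M : Type*} [AddCommGroup M] (C : AddSubgroup M) [Finite C]
    (hcard : Nat.card C = p) {T₁ : M} (hT₁ : T₁ ∈ C) (hT₁0 : T₁ ≠ 0) {T : M} (hT : T ∈ C) :
    ∃ k : ℤ, k • T₁ = T := by
  have hle : AddSubgroup.zmultiples T₁ ≤ C := AddSubgroup.zmultiples_le_of_mem hT₁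
  haveI : Finite (AddSubgroup.zmultiples T₁) := Finite.of_injective _ (AddSubgroup.inclusion_injective hle)
  have hdvd : Nat.card (AddSubgroup.zmultiples T₁) ∣ p := by
    rw [← hcard]; exact AddSubgroup.card_dvd_of_le hle
  rcases (Nat.dvd_prime hp.out).mp hdvd with h1 | hp'
  · exfalso
    have hbot : AddSubgroup.zmultiples T₁ = ⊥ := AddSubgroup.eq_bot_of_card_eq _ h1
    exact hT₁0 (AddSubgroup.zmultiples_eq_bot.mp hbot)
  · have heq : AddSubgroup.zmultiples T₁ = C :=
      AddSubgroup.eq_of_le_of_card_ge hle (by rw [hcard, hp'])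
    rw [← heq] at hT
    exact AddSubgroup.mem_zmultiples_iff.mp hT

/-- **`#H¹(Γ_{ℚ_v}, C) = p` for a `Γ`-stable line `C ≤ E(K̄_v)` of order `p` twisted as in
(α), (β)** (see the module docstring): from Tate's local Euler–Poincaré characteristic formula
(the named fact `hEP`, Milne *ADT* I Thm. 2.8), the tree's local duality in bidegree `(2,0)`
(`#H²(F, C) = #Hom_Γ(C, μ_p)`, Milne I Cor. 2.3), `C^Γ = 0` (by (α)), `Hom_Γ(C, μ_p) = 0` (by (β),
`p` odd) and `#(ℤ_v/p) = p`. `H¹` is Mathlib's `continuousCohomology 1` of the sub-representation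
of the local module `E(K̄_v)` on `C`. [cite: MilneADT2006, Ch. I §2, Thm. 2.8 and Cor. 2.3]
[cite: GreenbergLNM1716, §2 Props. 2.2, 2.4] -/
theorem natCard_H1_eq_of_line (hEP : localEulerPoincareCharacteristic (v.adicCompletion ℚ))
    (hp2 : p ≠ 2) (hpv : (p : 𝓞 ℚ) ∈ v.asIdeal) (W : WeierstrassCurve ℚ)
    (C : Submodule ℤ (localPoints W (v.adicCompletion ℚ)))
    (hC : ∀ σ : absoluteGaloisGroup (v.adicCompletion ℚ),
      C ≤ C.comap ((W.localGaloisModule (v.adicCompletion ℚ)) σ))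
    [Finite C] (hcard : Nat.card C = p)
    (hα : ∃ (ι : absoluteGaloisGroup (v.adicCompletion ℚ)) (T₁ : localPoints W (v.adicCompletion ℚ)),
      T₁ ∈ C ∧ T₁ ≠ 0 ∧ ι • T₁ = (2 : ℤ) • T₁)
    (hβ : ∃ (σ₀ : absoluteGaloisGroup (v.adicCompletion ℚ)) (a : ℕ)
      (T₁ : localPoints W (v.adicCompletion ℚ)),
      (∀ ζ : AlgebraicClosure (v.adicCompletion ℚ), ζ ^ p = 1 → σ₀ • ζ = ζ ^ a) ∧
      T₁ ∈ C ∧ T₁ ≠ 0 ∧ σ₀ • T₁ = -((a : ℤ) • T₁)) :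
    Finite (continuousCohomology 1
      (ContinuousRep.subrepresentation (W.localGaloisModule (v.adicCompletion ℚ)) C hC).toTopRep) ∧
    Nat.card (continuousCohomology 1
      (ContinuousRep.subrepresentation (W.localGaloisModule (v.adicCompletion ℚ)) C hC).toTopRep)
        = p := by
  have hpp : p.Prime := hp.out
  -- `H²` needs `LocallyCompactSpace Γ_F` (compactness of the absolute Galois group, a theorem of
  -- the tree, as an instance inside this proof only)
  haveI := absoluteGaloisGroup_compactSpace (v.adicCompletion ℚ)
  -- NB: no `CharZero ℚ_v` instance before the end (it would re-route `Algebra ℚ ℚ_v`).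
  haveI : NeZero ((p : ℕ) : v.adicCompletion ℚ) := ⟨by
    rw [← map_natCast (algebraMap ℚ (v.adicCompletion ℚ))]
    exact (map_ne_zero _).mpr (Nat.cast_ne_zero.mpr hpp.ne_zero)⟩
  set ρC := ContinuousRep.subrepresentation (W.localGaloisModule (v.adicCompletion ℚ)) C hC with hρC
  -- cyclicity of `C`
  have hcardC' : Nat.card C.toAddSubgroup = p := hcard
  haveI : Finite C.toAddSubgroup := ‹Finite C›
  have hcyc : ∀ {T₁ : localPoints W (v.adicCompletion ℚ)}, T₁ ∈ C → T₁ ≠ 0 → ∀ {T : localPoints W (v.adicCompletion ℚ)}, T ∈ C →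
      ∃ k : ℤ, k • T₁ = T := fun {T₁} hT₁ hT₁0 {T} hT ↦
    exists_zsmul_eq_of_card_prime C.toAddSubgroup hcardC' hT₁ hT₁0 hT
  -- the action of `Γ` on `C` through `ρC`
  have hρC_apply : ∀ (σ : absoluteGaloisGroup (v.adicCompletion ℚ)) (m : C), ((ρC σ m : C) : localPoints W (v.adicCompletion ℚ)) = σ • (m : localPoints W (v.adicCompletion ℚ)) :=
    fun σ m ↦ rfl
  -- (α) on all of `C`: `ι` acts by `2`
  obtain ⟨ι, T₁, hT₁, hT₁0, hι⟩ := hα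
  have hιall : ∀ T ∈ C, ι • T = (2 : ℤ) • T := by
    intro T hT
    obtain ⟨k, rfl⟩ := hcyc hT₁ hT₁0 hT
    rw [smul_zsmul_localPoints, hι, smul_smul, smul_smul, mul_comm]
  -- `C^Γ = 0`
  have hinv : Nat.card ρC.toTopRep.ρ.invariants = 1 := by
    haveI : Subsingleton ρC.toTopRep.ρ.invariants := by
      refine ⟨fun x y ↦ ?_⟩
      suffices h : ∀ z : ρC.toTopRep.ρ.invariants, z = 0 by rw [h x, h y]
      intro z
      have hz : ∀ g, ρC.toTopRep.ρ g z.1 = z.1 := (ContRepresentation.mem_invariants _).mp z.2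
      have h1 : ι • ((z.1 : C) : localPoints W (v.adicCompletion ℚ)) = ((z.1 : C) : localPoints W (v.adicCompletion ℚ)) := by
        rw [← hρC_apply]; exact congrArg Subtype.val (hz ι)
      rw [hιall _ (z.1 : C).2] at h1
      have h0 : ((z.1 : C) : localPoints W (v.adicCompletion ℚ)) = 0 := by
        have h2 : (2 : ℤ) • ((z.1 : C) : localPoints W (v.adicCompletion ℚ)) - ((z.1 : C) : localPoints W (v.adicCompletion ℚ)) = 0 :=
          sub_eq_zero.mpr h1
        rwa [show (2 : ℤ) • ((z.1 : C) : localPoints W (v.adicCompletion ℚ)) - ((z.1 : C) : localPoints W (v.adicCompletion ℚ)) =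
          ((z.1 : C) : localPoints W (v.adicCompletion ℚ)) by rw [two_zsmul, add_sub_cancel_right]] at h2
      exact Subtype.ext (Subtype.ext h0)
    exact Nat.card_of_subsingleton (0 : ρC.toTopRep.ρ.invariants)
  -- `#H² = #Hom_Γ(C, μ_p) = 1`
  have hM : ∀ m : C, p ^ 1 • m = 0 := fun m ↦ by
    rw [pow_one, ← hcard]; exact card_nsmul_eq_zero'
  have hhom : Nat.card (ρC.homRep (DiscreteGaloisModule.mu (v.adicCompletion ℚ) (p ^ 1))).toTopRep.ρ.invariants = 1 := by
    obtain ⟨σ₀, a, T₁', hσ₀μ, hT₁', hT₁'0, hσ₀T⟩ := hβ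
    -- `p ∤ a`: a primitive `p`-th root of unity is not killed by `σ₀`
    obtain ⟨ζ₁, hζ₁⟩ := HasEnoughRootsOfUnity.prim (M := AlgebraicClosure (v.adicCompletion ℚ)) (n := p)
    have hpa : ¬ p ∣ a := by
      intro hdvd
      have h1 : σ₀ • ζ₁ = 1 := by
        rw [hσ₀μ ζ₁ hζ₁.pow_eq_one]
        exact (hζ₁.pow_eq_one_iff_dvd a).mpr hdvd
      have h2 : ζ₁ = 1 := by
        have h3 : σ₀ • ζ₁ = σ₀ • (1 : AlgebraicClosure (v.adicCompletion ℚ)) := by rw [h1, smul_one]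
        exact smul_left_cancel σ₀ h3
      exact hζ₁.ne_one hpp.one_lt h2
    -- `σ₀` acts by `-a` on all of `C`
    have hσ₀all : ∀ T ∈ C, σ₀ • T = -((a : ℤ) • T) := by
      intro T hT
      obtain ⟨k, rfl⟩ := hcyc hT₁' hT₁'0 hT
      rw [smul_zsmul_localPoints, hσ₀T, smul_neg, smul_smul, smul_smul, mul_comm]
    haveI : Subsingleton (ρC.homRep (DiscreteGaloisModule.mu (v.adicCompletion ℚ) (p ^ 1))).toTopRep.ρ.invariants := by
      refine ⟨fun x y ↦ ?_⟩
      suffices h : ∀ z : (ρC.homRep (DiscreteGaloisModule.mu (v.adicCompletion ℚ) (p ^ 1))).toTopRep.ρ.invariants,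
          z = 0 by rw [h x, h y]
      intro z
      have hz : ∀ g, (ρC.homRep (DiscreteGaloisModule.mu (v.adicCompletion ℚ) (p ^ 1))) g z.1 = z.1 :=
        (ContRepresentation.mem_invariants _).mp z.2
      have heqv := (ContinuousRep.homRep_apply_eq_self_iff ρC (DiscreteGaloisModule.mu (v.adicCompletion ℚ) (p ^ 1))
        σ₀ z.1).mp (hz σ₀)
      -- every value of `f = z.1` is trivial
      have hval : ∀ m : C, (z.1 : HomCarrier C (DiscreteGaloisModule.MuCarrier (v.adicCompletion ℚ) (p ^ 1))) m = 0 := by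
        intro m
        set f := (z.1 : HomCarrier C (DiscreteGaloisModule.MuCarrier (v.adicCompletion ℚ) (p ^ 1))) with hf
        set u := muVal (v.adicCompletion ℚ) (p ^ 1) (f m) with hu
        have hu1 : u ^ (p ^ 1) = 1 := by rw [hu]; exact muVal_pow_eq_one _ _ _
        have hup : (u : AlgebraicClosure (v.adicCompletion ℚ)) ^ p = 1 := by
          have h := congrArg Units.val hu1
          rwa [pow_one, Units.val_pow_eq_pow_val, Units.val_one] at h
        -- `σ₀ f(m) = a f(m)`
        have hleft : DiscreteGaloisModule.mu (v.adicCompletion ℚ) (p ^ 1) σ₀ (f m) = a • f m := by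
          apply muVal_injective (v.adicCompletion ℚ) (p ^ 1)
          rw [muVal_apply, muVal_nsmul]
          apply Units.ext
          rw [Units.coe_smul, ← hu, Units.val_pow_eq_pow_val]
          exact hσ₀μ _ hup
        -- `f(σ₀ m) = -a f(m)`
        have hright : f (ρC σ₀ m) = -(a • f m) := by
          have hm : ρC σ₀ m = -((a : ℤ) • m) := by
            apply Subtype.ext
            rw [hρC_apply, hσ₀all _ m.2]
            simp
          rw [hm, map_neg, map_zsmul, natCast_zsmul]
        have hfix : a • f m = -(a • f m) := hleft.symm.trans ((heqv m).trans hright)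
        have h2a : (2 * a) • f m = 0 := by
          rw [mul_nsmul', two_nsmul]
          exact (eq_neg_iff_add_eq_zero.mp hfix)
        -- so `u ^ (2a) = 1`, and `u` has order dividing `p`: `u = 1`
        by_contra hne
        have hu1 : (u : AlgebraicClosure (v.adicCompletion ℚ)) ≠ 1 := by
          intro h1
          apply hne
          apply muVal_injective (v.adicCompletion ℚ) (p ^ 1)
          rw [muVal_zero, ← hu]
          exact Units.ext h1
        have hord : orderOf (u : AlgebraicClosure (v.adicCompletion ℚ)) = p := orderOf_eq_prime hup hu1
        have hpow : (u : AlgebraicClosure (v.adicCompletion ℚ)) ^ (2 * a) = 1 := by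
          rw [← Units.val_pow_eq_pow_val, hu, ← muVal_nsmul, h2a, muVal_zero, Units.val_one]
        have hdvd : p ∣ 2 * a := by
          rw [← hord]; exact orderOf_dvd_of_pow_eq_one hpow
        rcases (Nat.Prime.dvd_mul hpp).mp hdvd with h | h
        · have : p ≤ 2 := Nat.le_of_dvd two_pos h
          have : 2 ≤ p := hpp.two_le
          exact hp2 (by omega)
        · exact hpa h
      exact Subtype.ext (HomCarrier.ext fun m ↦ by rw [hval m]; rfl)
    exact Nat.card_of_subsingleton
      (0 : (ρC.homRep (DiscreteGaloisModule.mu (v.adicCompletion ℚ) (p ^ 1))).toTopRep.ρ.invariants)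
  -- local duality in bidegree `(2,0)` and Tate's local Euler–Poincaré characteristic
  haveI : CharZero (v.adicCompletion ℚ) := charZero_adicCompletion v
  obtain ⟨-, h2⟩ := natCard_two_eq_natCard_invariants_homRep (v.adicCompletion ℚ) ρC hM
  obtain ⟨hfin1, -, hEq⟩ := localEulerPoincareCharacteristic_adicCompletion ℚ v hEP ρC
  change Finite (continuousCohomology 1 ρC.toTopRep) at hfin1
  change _ * Nat.card (continuousCohomology 2 ρC.toTopRep) * _ =
    Nat.card (continuousCohomology 1 ρC.toTopRep) at hEq
  rw [hinv, h2, hhom, hcard, natCard_quot_adicCompletionIntegers_rat hpv, one_mul, one_mul] at hEq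
  exact ⟨hfin1, hEq.symm⟩

end Summit.BirchSwinnertonDyer.Rank1Residual.X11a.OrdinaryLine

end
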